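import Summits.HodgeConjecture.CorCM.Census.CyclicCharacterArcType
import Summits.HodgeConjecture.CorCM.Census.TwistGenerationModel

/-!
# Cyclic characters, VI: THE NEAR ZONE of the arc block — single flips `T_a^{(t)}`, their base changes, freeness, and their `2ᵏ⁻¹` blocks

COR-CM (cell `pub-hodgecm2`), count-neutral kernel combinatorics by the binder seat b09 (gen 41; lane CYCLIC-CHARACTER FIBRE LAW, part VIII — second half of
the MODEL for the μ-side road map `HOME/pub-hodgecm2-b09/lean-g41/METACYCLIC-ROADMAP.md`), on part VII (`Census/CyclicCharacterArcType.lean`: `arcType`,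
`rt_arcType`, `arcType_injective`) and b09ʼs intrinsic currency (`rt_oflipCM`: `Census/BlockParityLaw.lean`; `mem_oflipCM_iff'`: `Census/TwistGenerationModel.lean`;
`stab`: `Census/HalfParityBlocks.lean`), BY NAME.  Theorems only (no definition, no `decide`, no certificate, no named fact, no `sorry`).
HONEST FRAMING: `HC_CM` is NOT proved, here or anywhere in the tree; nothing here is a period or a headline.

SETTING of part VII (`c` central involution, `w : G → ℤ/2ᵏ` additive onto, `k ≥ 1`, `w c ≠ 0`; arc types `T_a`), plus a NON-TRIVIAL ODD KERNEL where stated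
(`∃ n ≠ 1, w n = 0` and every kernel element of odd order — the metacyclic column and every `N ⋊ ℤ/2ᵏ`, `|N| ≥ 3` odd).
* §1 the kernel acts trivially on arc types from the right inside `w`-fibres: `P·n ∈ T_a ↔ P ∈ T_a` (`mul_mem_arcType_iff`); base change of a SINGLE FLIP
  **`(T_a^{(t)})·Q⁻¹ = T_{a − wQ}^{(tQ⁻¹)}`** (`rt_oflipCM_arcType`) with the invariant `w(tQ⁻¹) − (a − wQ) = w t − a` (`flip_invariant`).
* §2 **a single flip is never an arc type** (`oflipCM_arcType_ne_arcType`, one kernel element `n ≠ 1` suffices: `t·n` witnesses), so the near zone splits into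
  the arc block (potential `0`) and the single flips (potential `1`);
* §3 **single flips determine their centre and their place** (`eq_of_oflipCM_arcType_eq`, `mem_orb_of_oflipCM_arcType_eq`; three kernel elements `1, n, n²`): `T_a^{(t)} = T_b^{(s)} ⇒
  a = b ∧ s ∈ {t, ct}`; hence **single flips are FREE** (`rt_oflipCM_arcType_eq_self_iff`: `(T_a^{(t)})·Q⁻¹ = T_a^{(t)} ↔ Q = 1`; `stab_oflipCM_arcType_eq_bot`);
* §4 **the single flips of one invariant form one block**: `T_a^{(t)}` and `T_b^{(s)}` lie in the same block iff `2·(w t − a) = 2·(w s − b)` in `ℤ/2ᵏ`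
  (`blk_oflipCM_arcType_eq_iff`) — `2ᵏ⁻¹` blocks of `|G|` types each (`k = 3`: the FOUR potential-one blocks of the road mapʼs `ℤ/3 ⋊ ℤ/8` numerics, for every
  odd kernel).

## References
* [Pohlmann1968] H. Pohlmann, Algebraic cycles on abelian varieties of complex multiplication type, Ann. of Math. 88 (1968), Thm 1.
* [Milne1999] J. S. Milne, Lefschetz motives and the Tate conjecture, Compositio Math. 117 (1999), Prop. 2.1, p. 54.
-/

namespace Summit.HodgeConjecture.CorCM.Census.CyclicCharacter

open Finset
open Summit.HodgeConjecture.CorCM.Prior.AllgGroup.RfwfAllgGroup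
open Summit.HodgeConjecture.CorCM.Census.BlockParity
open Summit.HodgeConjecture.CorCM.Census.HalfParity
open Summit.HodgeConjecture.CorCM.Census.TwistGeneration

noncomputable section

variable {G : Type*} [Group G] [Fintype G] [DecidableEq G] {k : ℕ} {w : G → ZMod (2 ^ k)} {c : G}

/-! ## §1 Kernel translations and base change of single flips -/

/-- **The kernel of `w` acts trivially inside the `w`-fibres**: `P·n ∈ T_a ↔ P ∈ T_a` for `w n = 0`. [folklore] -/
theorem mul_mem_arcType_iff (hw : ∀ P Q : G, w (P * Q) = w P + w Q) (hk : 1 ≤ k) (hc2 : c * c = 1) (hwc : w c ≠ 0) (a : ZMod (2 ^ k))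
    {n : G} (hn : w n = 0) (P : G) : P * n ∈ (arcType hw hk hc2 hwc a).1 ↔ P ∈ (arcType hw hk hc2 hwc a).1 := by
  rw [mem_arcType, mem_arcType, hw, hn, add_zero]

/-- **Base change of a single flip of an arc type: `(T_a^{(t)})·Q⁻¹ = T_{a − wQ}^{(tQ⁻¹)}`.** [folklore] -/
theorem rt_oflipCM_arcType (hw : ∀ P Q : G, w (P * Q) = w P + w Q) (hk : 1 ≤ k) (hc2 : c * c = 1) (hwc : w c ≠ 0) (Q t : G) (a : ZMod (2 ^ k)) :
    rt c Q (oflipCM c hc2 t (arcType hw hk hc2 hwc a)) = oflipCM c hc2 (t * Q⁻¹) (arcType hw hk hc2 hwc (a - w Q)) := by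
  rw [rt_oflipCM, rt_arcType]

omit [Fintype G] [DecidableEq G] in
/-- **The flip invariant is base-change invariant**: `w (tQ⁻¹) − (a − w Q) = w t − a`. [folklore] -/
theorem flip_invariant (hw : ∀ P Q : G, w (P * Q) = w P + w Q) (Q t : G) (a : ZMod (2 ^ k)) : w (t * Q⁻¹) - (a - w Q) = w t - a := by
  rw [hw, map_inv hw]; abel

omit [Fintype G] [DecidableEq G] in
/-- The flip invariant at the other point of the place: `w (ct) − a = (w t − a) + 2ᵏ⁻¹`, so `2·(w (ct) − a) = 2·(w t − a)`. [folklore] -/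
theorem two_nsmul_flip_invariant_cmul (hw : ∀ P Q : G, w (P * Q) = w P + w Q) (hk : 1 ≤ k) (hc2 : c * c = 1) (hwc : w c ≠ 0) (t : G) (a : ZMod (2 ^ k)) :
    2 • (w (c * t) - a) = 2 • (w t - a) := by
  have h2k : 2 ^ k = 2 * 2 ^ (k - 1) := by rw [← pow_succ', Nat.sub_add_cancel hk]
  rw [hw, apply_c hw hk hc2 hwc, two_nsmul, two_nsmul]
  have h0 : ((2 ^ (k - 1) : ℕ) : ZMod (2 ^ k)) + ((2 ^ (k - 1) : ℕ) : ZMod (2 ^ k)) = 0 := by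
    rw [← Nat.cast_add, ← two_mul, ← h2k, ZMod.natCast_self]
  linear_combination h0

/-! ## §2 A single flip is never an arc type -/

/-- **`T_a^{(t)} ≠ T_b`** as soon as the kernel of `w` has an element `n ≠ 1` (test the points `t` and `t·n`). [folklore] -/
theorem oflipCM_arcType_ne_arcType (hw : ∀ P Q : G, w (P * Q) = w P + w Q) (hk : 1 ≤ k) (hc2 : c * c = 1) (hcen : ∀ x : G, x * c = c * x)
    (hwc : w c ≠ 0) {n : G} (hn1 : n ≠ 1) (hn : w n = 0) (t : G) (a b : ZMod (2 ^ k)) :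
    oflipCM c hc2 t (arcType hw hk hc2 hwc a) ≠ arcType hw hk hc2 hwc b := by
  intro h
  have hmem := fun x => congrArg (fun Ψ : CMF G c => x ∈ Ψ.1) h
  -- `t·n` is off the place of `t`
  have htn : t * n ∉ orb c t := by
    rw [mem_orb]
    rintro (h1 | h2)
    · exact hn1 (mul_left_cancel (h1.trans (mul_one t).symm))
    · apply hwc
      rw [← hcen t] at h2
      rw [← mul_left_cancel h2]
      exact hn
  have ht : t ∈ orb c t := (mem_orb c).mpr (Or.inl rfl)
  have e1 := hmem t
  have e2 := hmem (t * n)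
  simp only [mem_oflipCM_iff', eq_iff_iff] at e1 e2
  rw [mul_mem_arcType_iff hw hk hc2 hwc a hn, mul_mem_arcType_iff hw hk hc2 hwc b hn] at e2
  tauto

/-! ## §3 Single flips determine centre and place; they are free -/

/-- **Two kernel elements off a place**: for `n ≠ 1` in the kernel with `n² ≠ 1` (odd order), the points `t·n`, `t·n²` are off the places of `t` and `s`
unless … — the counting core: a `w`-saturated, `c`-stable non-empty set of points has more than four points. [folklore] -/
theorem exists_mem_symmDiff_notMem (hw : ∀ P Q : G, w (P * Q) = w P + w Q) (hk : 1 ≤ k) (hc2 : c * c = 1)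
    (hwc : w c ≠ 0) {n : G} (hn1 : n ≠ 1) (hn2 : n * n ≠ 1) (hn : w n = 0) {a b : ZMod (2 ^ k)} (hab : a ≠ b) (h1 : ∃ g₁ : G, w g₁ = 1)
    (t s : G) : ∃ x : G, ¬ (x ∈ (arcType hw hk hc2 hwc a).1 ↔ x ∈ (arcType hw hk hc2 hwc b).1) ∧ x ∉ orb c t ∧ x ∉ orb c s := by
  -- a point `g` where `T_a`, `T_b` differ (injectivity of `a ↦ T_a` gives one)
  have hne : arcType hw hk hc2 hwc a ≠ arcType hw hk hc2 hwc b := fun h => hab (arcType_injective hw hk hc2 hwc h1 h)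
  obtain ⟨g, hg⟩ : ∃ g : G, ¬ (g ∈ (arcType hw hk hc2 hwc a).1 ↔ g ∈ (arcType hw hk hc2 hwc b).1) := by
    by_contra hall
    push Not at hall
    exact hne (Subtype.ext (Finset.ext hall))
  -- the three points `g`, `g n`, `g n²` all lie in the difference; at most two of any three distinct points off... use: the orbits of `t`, `s` hold ≤ 4 points,
  -- and `g, gn, gn², cg·?`: we use the five points `g, gn, gn², c g… ` — simpler: among `g, g n, g n n` (pairwise distinct, same `w`-value) and their
  -- `c`-translates, pick one outside both places by counting memberships.
  have hdiff : ∀ m : G, w m = 0 → ¬ (g * m ∈ (arcType hw hk hc2 hwc a).1 ↔ g * m ∈ (arcType hw hk hc2 hwc b).1) := by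
    intro m hm
    rw [mul_mem_arcType_iff hw hk hc2 hwc a hm, mul_mem_arcType_iff hw hk hc2 hwc b hm]
    exact hg
  -- the candidates `g·1, g·n, g·n²` are pairwise distinct and none is `c` times another (that would put `c` in the kernel)
  have hnn : w (n * n) = 0 := by rw [hw, hn, add_zero]
  have key : ∀ m m' : G, w m = 0 → w m' = 0 → g * m ≠ c * (g * m') := by
    intro m m' hm hm' h
    apply hwc
    have : c = g * m * (g * m')⁻¹ := by rw [h, mul_inv_cancel_right]
    rw [this, hw, map_inv hw, hw, hw, hm, hm']
    abel
  -- each place `orb c u = {u, c u}` contains at most ONE of the three candidates (two of them would coincide or differ by `c`)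
  have one_per_orb : ∀ u m m' : G, w m = 0 → w m' = 0 → g * m ∈ orb c u → g * m' ∈ orb c u → m = m' := by
    intro u m m' hm hm' h h'
    rw [mem_orb] at h h'
    rcases h with h | h <;> rcases h' with h' | h'
    · exact mul_left_cancel (h.trans h'.symm)
    · exact absurd (h'.trans ((congrArg (c * ·) h).symm)) (key m' m hm' hm)
    · exact absurd (h.trans ((congrArg (c * ·) h').symm)) (key m m' hm hm')
    · exact mul_left_cancel (h.trans h'.symm)
  -- pigeonhole: three candidates, two places
  have hn_ne : (1 : G) ≠ n := fun e => hn1 e.symm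
  have hnn_ne : n ≠ n * n := fun e => hn1 (mul_left_cancel (e.symm.trans (mul_one n).symm))
  have h1nn : (1 : G) ≠ n * n := fun e => hn2 e.symm
  by_contra hnone
  have hforce : ∀ x : G, ¬ (x ∈ (arcType hw hk hc2 hwc a).1 ↔ x ∈ (arcType hw hk hc2 hwc b).1) → x ∉ orb c t → x ∈ orb c s :=
    fun x hx hxt => by
      by_contra hxs
      exact hnone ⟨x, hx, hxt, hxs⟩
  have h0 := hforce (g * 1) (hdiff 1 (map_one hw))
  have h1' := hforce (g * n) (hdiff n hn)
  have h2 := hforce (g * (n * n)) (hdiff (n * n) hnn)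
  rcases em (g * 1 ∈ orb c t) with ht0 | ht0 <;> rcases em (g * n ∈ orb c t) with ht1 | ht1 <;>
    rcases em (g * (n * n) ∈ orb c t) with ht2 | ht2
  · exact hn_ne (one_per_orb t 1 n (map_one hw) hn ht0 ht1)
  · exact hn_ne (one_per_orb t 1 n (map_one hw) hn ht0 ht1)
  · exact h1nn (one_per_orb t 1 (n * n) (map_one hw) hnn ht0 ht2)
  · exact hnn_ne (one_per_orb s n (n * n) hn hnn (h1' ht1) (h2 ht2))
  · exact hnn_ne (one_per_orb t n (n * n) hn hnn ht1 ht2)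
  · exact h1nn (one_per_orb s 1 (n * n) (map_one hw) hnn (h0 ht0) (h2 ht2))
  · exact hn_ne (one_per_orb s 1 n (map_one hw) hn (h0 ht0) (h1' ht1))
  · exact hn_ne (one_per_orb s 1 n (map_one hw) hn (h0 ht0) (h1' ht1))

/-- **A single flip determines its centre**: `T_a^{(t)} = T_b^{(s)} ⇒ a = b` (kernel with an element `n` of order `≥ 3`, `w` onto). [folklore] -/
theorem eq_of_oflipCM_arcType_eq (hw : ∀ P Q : G, w (P * Q) = w P + w Q) (hk : 1 ≤ k) (hc2 : c * c = 1)
    (hwc : w c ≠ 0) {n : G} (hn1 : n ≠ 1) (hn2 : n * n ≠ 1) (hn : w n = 0) (h1 : ∃ g₁ : G, w g₁ = 1) {a b : ZMod (2 ^ k)} {t s : G}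
    (h : oflipCM c hc2 t (arcType hw hk hc2 hwc a) = oflipCM c hc2 s (arcType hw hk hc2 hwc b)) : a = b := by
  by_contra hab
  obtain ⟨x, hx, hxt, hxs⟩ := exists_mem_symmDiff_notMem hw hk hc2 hwc hn1 hn2 hn hab h1 t s
  have e := congrArg (fun Ψ : CMF G c => x ∈ Ψ.1) h
  simp only [mem_oflipCM_iff', eq_iff_iff] at e
  tauto

/-- **A single flip determines its place**: `T_a^{(t)} = T_a^{(s)} ⇒ s ∈ {t, ct}`. [folklore] -/
theorem mem_orb_of_oflipCM_arcType_eq (hw : ∀ P Q : G, w (P * Q) = w P + w Q) (hk : 1 ≤ k) (hc2 : c * c = 1) (hwc : w c ≠ 0)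
    {a : ZMod (2 ^ k)} {t s : G} (h : oflipCM c hc2 t (arcType hw hk hc2 hwc a) = oflipCM c hc2 s (arcType hw hk hc2 hwc a)) : s ∈ orb c t := by
  by_contra hst
  have hs : s ∈ orb c s := (mem_orb c).mpr (Or.inl rfl)
  have e := congrArg (fun Ψ : CMF G c => s ∈ Ψ.1) h
  simp only [mem_oflipCM_iff', eq_iff_iff] at e
  tauto

/-- **SINGLE FLIPS ARE FREE**: `(T_a^{(t)})·Q⁻¹ = T_a^{(t)} ↔ Q = 1` (kernel with an element of order `≥ 3`, `c` central, `w` onto). [folklore] -/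
theorem rt_oflipCM_arcType_eq_self_iff (hw : ∀ P Q : G, w (P * Q) = w P + w Q) (hk : 1 ≤ k) (hc2 : c * c = 1) (hcen : ∀ x : G, x * c = c * x)
    (hwc : w c ≠ 0) {n : G} (hn1 : n ≠ 1) (hn2 : n * n ≠ 1) (hn : w n = 0) (h1 : ∃ g₁ : G, w g₁ = 1) (Q t : G) (a : ZMod (2 ^ k)) :
    rt c Q (oflipCM c hc2 t (arcType hw hk hc2 hwc a)) = oflipCM c hc2 t (arcType hw hk hc2 hwc a) ↔ Q = 1 := by
  refine ⟨fun h => ?_, fun h => by rw [h, rt_one]⟩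
  rw [rt_oflipCM_arcType] at h
  have hwQ : w Q = 0 := by
    have := eq_of_oflipCM_arcType_eq hw hk hc2 hwc hn1 hn2 hn h1 h
    rwa [sub_eq_self] at this
  rw [hwQ, sub_zero] at h
  have horb := mem_orb_of_oflipCM_arcType_eq hw hk hc2 hwc h.symm
  rw [mem_orb] at horb
  rcases horb with h' | h'
  · -- `t Q⁻¹ = t`
    have : Q⁻¹ = 1 := mul_left_cancel (h'.trans (mul_one t).symm)
    exact inv_eq_one.mp this
  · -- `t Q⁻¹ = c t` puts `c` in the kernel
    exfalso
    apply hwc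
    rw [← hcen t] at h'
    have hQ : Q⁻¹ = c := mul_left_cancel h'
    rw [← hQ, map_inv hw, hwQ, neg_zero]

/-- **The stabiliser of a single flip is trivial.** [folklore] -/
theorem stab_oflipCM_arcType_eq_bot (hw : ∀ P Q : G, w (P * Q) = w P + w Q) (hk : 1 ≤ k) (hc2 : c * c = 1) (hcen : ∀ x : G, x * c = c * x)
    (hwc : w c ≠ 0) {n : G} (hn1 : n ≠ 1) (hn2 : n * n ≠ 1) (hn : w n = 0) (h1 : ∃ g₁ : G, w g₁ = 1) (t : G) (a : ZMod (2 ^ k)) :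
    stab c (oflipCM c hc2 t (arcType hw hk hc2 hwc a)) = ⊥ := by
  rw [eq_bot_iff]
  intro Q hQ
  rw [mem_stab, rt_oflipCM_arcType_eq_self_iff hw hk hc2 hcen hwc hn1 hn2 hn h1] at hQ
  exact hQ

/-! ## §4 The blocks of the single flips -/

/-- Single flips with the same doubled invariant are base changes of one another: if `2·(w t − a) = 2·(w s − b)` then `T_b^{(s)} = (T_a^{(t)})·Q⁻¹` for some `Q`
(`w` onto). [folklore] -/
theorem exists_rt_oflipCM_arcType_eq (hw : ∀ P Q : G, w (P * Q) = w P + w Q) (hk : 1 ≤ k) (hc2 : c * c = 1)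
    (hwc : w c ≠ 0) {a b : ZMod (2 ^ k)} {t s : G} (h : 2 • (w t - a) = 2 • (w s - b)) :
    ∃ Q : G, rt c Q (oflipCM c hc2 t (arcType hw hk hc2 hwc a)) = oflipCM c hc2 s (arcType hw hk hc2 hwc b) := by
  -- `w s − b = (w t − a)` or `= (w t − a) + 2ᵏ⁻¹`; in the second case replace `s` by `c s` (same flip)
  have hcases : w s - b = w t - a ∨ w s - b = w t - a + ((2 ^ (k - 1) : ℕ) : ZMod (2 ^ k)) := by
    have h2 : (w s - b - (w t - a)) + (w s - b - (w t - a)) = 0 := by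
      have := sub_eq_zero.mpr h.symm
      rw [two_nsmul, two_nsmul] at this
      linear_combination this
    rcases (add_self_eq_zero_iff hk _).mp h2 with h0 | h0
    · left; exact (sub_eq_zero.mp h0)
    · right; rw [← h0]; abel
  -- choose `s' ∈ {s, c s}` with `w s' − b = w t − a`
  obtain ⟨s', hs'flip, hs'⟩ : ∃ s' : G, oflipCM c hc2 s' (arcType hw hk hc2 hwc b) = oflipCM c hc2 s (arcType hw hk hc2 hwc b) ∧ w s' - b = w t - a := by
    rcases hcases with h0 | h0
    · exact ⟨s, rfl, h0⟩
    · refine ⟨c * s, oflipCM_cmul c hc2 s _, ?_⟩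
      have h2k : 2 ^ k = 2 * 2 ^ (k - 1) := by rw [← pow_succ', Nat.sub_add_cancel hk]
      have hcc : ((2 ^ (k - 1) : ℕ) : ZMod (2 ^ k)) + ((2 ^ (k - 1) : ℕ) : ZMod (2 ^ k)) = 0 := by
        rw [← Nat.cast_add, ← two_mul, ← h2k, ZMod.natCast_self]
      rw [hw, apply_c hw hk hc2 hwc, show ((2 ^ (k - 1) : ℕ) : ZMod (2 ^ k)) + w s - b = (w s - b) + ((2 ^ (k - 1) : ℕ) : ZMod (2 ^ k)) by abel,
        h0, add_assoc, hcc, add_zero]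
  -- `Q` with `t Q⁻¹ = s'`: `Q = s'⁻¹ t`; then `w Q = w t − w s' = a − b`
  refine ⟨s'⁻¹ * t, ?_⟩
  rw [← hs'flip, rt_oflipCM_arcType, mul_inv_rev, inv_inv, ← mul_assoc, mul_inv_cancel, one_mul]
  congr 2
  rw [hw, map_inv hw]
  linear_combination hs'

/-- Conversely, types in one block have the same doubled invariant. [folklore] -/
theorem two_nsmul_eq_of_rt_oflipCM_arcType_eq (hw : ∀ P Q : G, w (P * Q) = w P + w Q) (hk : 1 ≤ k) (hc2 : c * c = 1)
    (hwc : w c ≠ 0) {n : G} (hn1 : n ≠ 1) (hn2 : n * n ≠ 1) (hn : w n = 0) (h1 : ∃ g₁ : G, w g₁ = 1) {a b : ZMod (2 ^ k)} {t s Q : G}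
    (h : rt c Q (oflipCM c hc2 t (arcType hw hk hc2 hwc a)) = oflipCM c hc2 s (arcType hw hk hc2 hwc b)) : 2 • (w t - a) = 2 • (w s - b) := by
  rw [rt_oflipCM_arcType] at h
  have hab : a - w Q = b := eq_of_oflipCM_arcType_eq hw hk hc2 hwc hn1 hn2 hn h1 h
  rw [hab] at h
  have horb := mem_orb_of_oflipCM_arcType_eq hw hk hc2 hwc h
  rw [← flip_invariant hw Q t a, hab]
  rw [mem_orb] at horb
  rcases horb with h' | h'
  · rw [h']
  · rw [h', two_nsmul_flip_invariant_cmul hw hk hc2 hwc]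

/-- **THE BLOCKS OF THE SINGLE FLIPS**: `T_a^{(t)}` and `T_b^{(s)}` lie in the same block iff `2·(w t − a) = 2·(w s − b)` in `ℤ/2ᵏ` — `2ᵏ⁻¹` blocks, each free
(kernel with an element of order `≥ 3`, `c` central, `w` onto). [folklore] -/
theorem blk_oflipCM_arcType_eq_iff (hw : ∀ P Q : G, w (P * Q) = w P + w Q) (hk : 1 ≤ k) (hc2 : c * c = 1)
    (hwc : w c ≠ 0) {n : G} (hn1 : n ≠ 1) (hn2 : n * n ≠ 1) (hn : w n = 0) (h1 : ∃ g₁ : G, w g₁ = 1) (a b : ZMod (2 ^ k)) (t s : G) :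
    blk c (oflipCM c hc2 t (arcType hw hk hc2 hwc a)) = blk c (oflipCM c hc2 s (arcType hw hk hc2 hwc b)) ↔ 2 • (w t - a) = 2 • (w s - b) := by
  constructor
  · intro h
    obtain ⟨Q, hQ⟩ := exists_rt_eq_of_blk_eq c h
    exact two_nsmul_eq_of_rt_oflipCM_arcType_eq hw hk hc2 hwc hn1 hn2 hn h1 hQ
  · intro h
    obtain ⟨Q, hQ⟩ := exists_rt_oflipCM_arcType_eq hw hk hc2 hwc h
    rw [← hQ, blk_rt]

end

end Summit.HodgeConjecture.CorCM.Census.CyclicCharacter
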